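import Summits.AtomisticToContinuum.Crystallization.Theorems.ChartedZeroExcessLayeredLatticeLiouvilleUO
import Summits.AtomisticToContinuum.Crystallization.Theorems.ChartedPlanarOrderChannelJacobianForce

/-!
# Zero-excess layered lattice Liouville — part UP (lens-2 g55, node «GluePiecesProved»): (I1) `PairForceTaylorP` PROVED (uniform second-order expansion
# of the Lennard-Jones pair force off the core, `C = 2·10⁷`), and the glue of part UN with its three PROVABLE·S antecedents (I0), (I1), (I5) DISCHARGED:
# [CC°_Ψᵇ] ⟸ `CaccioppoliGlueBPG` ∧ (I4) `TailFluxBP` ∧ hU ∧ hN ∧ [KS] ∧ [SBᵇ] (`coherentGscCaccioppoliPsiBPG_of_pieces'`, PROVED modus ponens).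

Continuation of part UO (critic row 869, option (1)).  This part imports, besides part UO, the TREE module `…ChartedPlanarOrderChannelJacobianForce` (lens-5:
the pair-force Jacobian `pairJac`, `hasFDerivAt_pairForce`), which is not in the import closure of parts TA…UO.  FINDINGS.
(u3) (I1) — `forceConst z = −D pairForce z` ON THE NOSE: part B's `forceConst w` and the tree Jacobian `pairJac w` have the same coefficient polynomials in
  `(‖w‖²)⁻¹` (`forceConst_apply_eq_neg_pairJac`, by `module`).  For `‖z‖ ≥ 27/32` and `‖y − z‖ ≤ 1/4` (so `‖y‖ ≥ 19/32`, `‖z‖ ≤ ‖y‖ + 1/4`) the Jacobian is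
  Lipschitz, `‖pairJac y − pairJac z‖ ≤ 2·10⁷·‖y − z‖` (`norm_pairJac_sub_le`; the scalar bookkeeping `pairJac_coeff_bound` is crude — every inverse norm is
  bounded by `2` — since (I1) only asks for SOME constant), and the mean-value inequality on the convex ball `closedBall z ‖h‖` against the FIXED linear map
  `pairJac z` bounds the Taylor remainder by `2·10⁷·‖h‖·‖h‖` (`pairForceTaylorP_holds`).
(u4) With (I0), (I5) (part UO) and (I1) PROVED, the typed reduction of part UN reads [CC°_Ψᵇ] ⟸ glue ∧ (I4) ∧ hU ∧ hN ∧ [KS] ∧ [SBᵇ]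
  (`coherentGscCaccioppoliPsiBPG_of_pieces'`); the record example runs the docket of record `strainNonConcentrationBPG_1_50_of_docketPsi` at column
  `_16XH19B`'s literals with three hypotheses fewer than part UN's.
CONTENTS §UP.1 (I1) PROVED; §UP.2 the glue with (I0), (I1), (I5) discharged (PROVED), record example.  RESIDUALS of the line after this part: [T_bᵇ]
`BareTameWindowBPG`; [W_Ψᵇ] `CoherentWindowPsiBPG` (split embargoed with [W]); beneath [CC°_Ψᵇ]: the glue `CaccioppoliGlueBPG` (MECHANISM-KNOWN · ATTACKABLE·M–L),
(I4) `TailFluxBP` (TRUE-type · ATTACKABLE·M), [SBᵇ] `SubWindowBudgetBPG` (UNDECIDED · INSTRUMENTABLE); tree certs hU `UniformTameStabilityE`, hN `EnergyNearChartPX`,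
[KS] `KornSobolevPoincareP`.  No `sorry`, no new axiom, no instance / notation / option; no new `def`.  Literature: folklore calculus (mean-value inequality in
Banach spaces, Mathlib `Convex.norm_image_sub_le_of_norm_hasFDerivWithin_le'`); parts B (`forceConst`), UN, UO; lens-5 `…ChannelJacobianForce`.
-/

noncomputable section

open scoped BigOperators InnerProductSpace RealInnerProductSpace
open MeasureTheory Set Metric Filter Topology
open Summit.AtomisticToContinuum.Crystallization.Theorems.ChartedPlanarOrderRigidityDoor (E3 atomsIn)
open Summit.AtomisticToContinuum.Crystallization.Theorems.ChartedPlanarOrderDensityDichotomy (μS IsSep nK nK_nonneg)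
open Summit.AtomisticToContinuum.Crystallization.Theorems.ChartedPlanarOrderCleanScaleP (IsCleanP IsDoorSetP)
open Summit.AtomisticToContinuum.Crystallization.Theorems.ChartedPlanarOrderMesoCut (LayeredHom EnvClose)
open Summit.AtomisticToContinuum.Crystallization.Theorems.ChartedPlanarOrderDoorLayered (atomsIn_subset)
open Summit.AtomisticToContinuum.Crystallization.Theorems.ChartedPlanarOrderDoorLayeredOsc (IsTwoShellAffineGood)
open Summit.AtomisticToContinuum.Crystallization.Theorems.ChartedPlanarOrderProfileSlavingLJ (pairForce)
open Summit.AtomisticToContinuum.Crystallization.Theorems.ChartedPlanarOrderChannelJacobian (radial radial' pairJac pairJac_apply hasFDerivAt_pairForce)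
open Literature.Analysis.PDE (finavg ZatorskaGoldstein2005_localGehringLemmaCounting)

namespace Summit.AtomisticToContinuum.Crystallization.Theorems.ChartedZeroExcessLayeredLatticeLiouville

/-! ### UP.1  (I1) Uniform second-order expansion of the pair force off the core (PROVED) -/

/-- part B's bond force-constant operator is MINUS the tree Jacobian `pairJac` of the pair force (`…ChannelJacobianForce`), applied form: the two coefficient
polynomials agree definitionally (`radial`, `radial'` at `‖w‖²`). [this file, g55] -/
theorem forceConst_apply_eq_neg_pairJac (w d : E3) : forceConst w d = -(pairJac w d) := by
  rw [forceConst_apply, pairJac_apply]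
  simp only [radial, radial']
  module

/-- scalar bookkeeping for the Lipschitz bound of the pair Jacobian: for `19/32 ≤ a`, `27/32 ≤ b`, `|a − b| ≤ d`, `b ≤ a + 1/4` the three coefficient
groups of `pairJac y − pairJac z` (`a = ‖y‖`, `b = ‖z‖`; radial difference, angular term, angular difference) total `≤ 2·10⁷·d` (crude: every inverse norm
`≤ 2`, `|u⁷ − v⁷| ≤ 7·max(u,v)⁶·|u − v|`). [this file, g55] -/
theorem pairJac_coeff_bound {a b d : ℝ} (ha : 19 / 32 ≤ a) (hb : 27 / 32 ≤ b) (hab : |a - b| ≤ d)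
    (hba' : b ≤ a + 1 / 4) :
    |((a ^ 2)⁻¹ ^ 7 - (a ^ 2)⁻¹ ^ 4) - ((b ^ 2)⁻¹ ^ 7 - (b ^ 2)⁻¹ ^ 4)|
      + 2 * |-7 * (a ^ 2)⁻¹ ^ 8 + 4 * (a ^ 2)⁻¹ ^ 5| * (a + b) * d
      + 2 * |(-7 * (a ^ 2)⁻¹ ^ 8 + 4 * (a ^ 2)⁻¹ ^ 5) - (-7 * (b ^ 2)⁻¹ ^ 8 + 4 * (b ^ 2)⁻¹ ^ 5)| * b ^ 2
      ≤ 20000000 * d := by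
  have ha0 : 0 < a := by linarith
  have hb0 : 0 < b := by linarith
  have hd0 : 0 ≤ d := (abs_nonneg _).trans hab
  set ia : ℝ := a⁻¹ with hia_def
  set ib : ℝ := b⁻¹ with hib_def
  have hia0 : 0 < ia := inv_pos.2 ha0
  have hib0 : 0 < ib := inv_pos.2 hb0
  have hia1 : ia * a = 1 := inv_mul_cancel₀ ha0.ne'
  have hib1 : ib * b = 1 := inv_mul_cancel₀ hb0.ne'
  have hia : ia ≤ 2 := by
    have h := inv_anti₀ (by norm_num : (0 : ℝ) < 1 / 2) (by linarith : 1 / 2 ≤ a)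
    rw [hia_def]
    linarith [show ((1 : ℝ) / 2)⁻¹ = 2 by norm_num]
  have hib : ib ≤ 2 := by
    have h := inv_anti₀ (by norm_num : (0 : ℝ) < 1 / 2) (by linarith : 1 / 2 ≤ b)
    rw [hib_def]
    linarith [show ((1 : ℝ) / 2)⁻¹ = 2 by norm_num]
  have hu : (a ^ 2)⁻¹ = ia ^ 2 := by rw [hia_def, inv_pow]
  have hv : (b ^ 2)⁻¹ = ib ^ 2 := by rw [hib_def, inv_pow]
  rw [hu, hv]
  -- powers of `ia`, `ib` are bounded by powers of two
  have hpa : ∀ n : ℕ, ia ^ n ≤ 2 ^ n := fun n => pow_le_pow_left₀ hia0.le hia n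
  have hpb : ∀ n : ℕ, ib ^ n ≤ 2 ^ n := fun n => pow_le_pow_left₀ hib0.le hib n
  have hu4 : ia ^ 2 ≤ 4 := by
    have h := hpa 2
    norm_num at h
    exact h
  have hv4 : ib ^ 2 ≤ 4 := by
    have h := hpb 2
    norm_num at h
    exact h
  have hmax : max |ia ^ 2| |ib ^ 2| ≤ 4 :=
    max_le (by rw [abs_of_nonneg (sq_nonneg _)]; exact hu4) (by rw [abs_of_nonneg (sq_nonneg _)]; exact hv4)
  have hmax0 : 0 ≤ max |ia ^ 2| |ib ^ 2| := le_max_of_le_left (abs_nonneg _)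
  -- `|ia² − ib²| ≤ 16 d` and `|ia² − ib²| b² ≤ 5 d`
  have e0 : ia ^ 2 - ib ^ 2 = (b - a) * (ia * ib * (ia + ib)) := by
    calc ia ^ 2 - ib ^ 2 = (ia - ib) * (ia + ib) := by ring
      _ = ((ib * b) * ia - (ia * a) * ib) * (ia + ib) := by rw [hia1, hib1]; ring
      _ = (b - a) * (ia * ib * (ia + ib)) := by ring
  have hba : |b - a| ≤ d := by rw [abs_sub_comm]; exact hab
  have hprod0 : 0 < ia * ib * (ia + ib) := by positivity
  have huv : |ia ^ 2 - ib ^ 2| ≤ 16 * d := by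
    rw [e0, abs_mul, abs_of_pos hprod0]
    have h2 : ia * ib * (ia + ib) ≤ 16 := by
      have h3 := mul_le_mul hia hib hib0.le zero_le_two
      have h4 := mul_le_mul h3 (by linarith : ia + ib ≤ 4) (by positivity) (by norm_num)
      linarith
    calc |b - a| * (ia * ib * (ia + ib)) ≤ d * 16 := mul_le_mul hba h2 hprod0.le hd0
      _ = 16 * d := by ring
  have huvb : |ia ^ 2 - ib ^ 2| * b ^ 2 ≤ 5 * d := by
    rw [e0, abs_mul, abs_of_pos hprod0]
    have e1 : ia * ib * (ia + ib) * b ^ 2 = ia ^ 2 * b + ia := by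
      calc ia * ib * (ia + ib) * b ^ 2 = ia ^ 2 * b * (ib * b) + ia * (ib * b) ^ 2 := by ring
        _ = ia ^ 2 * b + ia := by rw [hib1]; ring
    have h3 : ia ^ 2 * b + ia ≤ 5 := by
      have h4 : ia ^ 2 * b ≤ ia ^ 2 * (a + 1 / 4) := mul_le_mul_of_nonneg_left hba' (sq_nonneg _)
      have h5 : ia ^ 2 * a = ia := by
        calc ia ^ 2 * a = ia * (ia * a) := by ring
          _ = ia := by rw [hia1, mul_one]
      have h6 : ia ^ 2 * (a + 1 / 4) = ia ^ 2 * a + ia ^ 2 / 4 := by ring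
      linarith
    calc |b - a| * (ia * ib * (ia + ib)) * b ^ 2 = |b - a| * (ia * ib * (ia + ib) * b ^ 2) := by ring
      _ ≤ d * 5 := by rw [e1]; exact mul_le_mul hba h3 (by positivity) hd0
      _ = 5 * d := by ring
  -- group 1: `|Δ radial| ≤ 16 d (7·4⁶ + 4·4³)`
  have h7 := abs_pow_sub_pow_le (ia ^ 2) (ib ^ 2) 7
  have h4' := abs_pow_sub_pow_le (ia ^ 2) (ib ^ 2) 4
  simp only [Nat.cast_ofNat, show (7 : ℕ) - 1 = 6 from rfl, show (4 : ℕ) - 1 = 3 from rfl] at h7 h4'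
  have hm6 : max |ia ^ 2| |ib ^ 2| ^ 6 ≤ 4 ^ 6 := pow_le_pow_left₀ hmax0 hmax 6
  have hm3 : max |ia ^ 2| |ib ^ 2| ^ 3 ≤ 4 ^ 3 := pow_le_pow_left₀ hmax0 hmax 3
  have hG1 : |((ia ^ 2) ^ 7 - (ia ^ 2) ^ 4) - ((ib ^ 2) ^ 7 - (ib ^ 2) ^ 4)| ≤ 470000 * d := by
    have e : ((ia ^ 2) ^ 7 - (ia ^ 2) ^ 4) - ((ib ^ 2) ^ 7 - (ib ^ 2) ^ 4) =
        ((ia ^ 2) ^ 7 - (ib ^ 2) ^ 7) - ((ia ^ 2) ^ 4 - (ib ^ 2) ^ 4) := by ring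
    rw [e]
    refine (abs_sub _ _).trans ?_
    have h7' : |(ia ^ 2) ^ 7 - (ib ^ 2) ^ 7| ≤ 16 * d * 7 * 4 ^ 6 :=
      h7.trans (mul_le_mul (mul_le_mul_of_nonneg_right huv (by norm_num)) hm6 (by positivity) (by positivity))
    have h4'' : |(ia ^ 2) ^ 4 - (ib ^ 2) ^ 4| ≤ 16 * d * 4 * 4 ^ 3 :=
      h4'.trans (mul_le_mul (mul_le_mul_of_nonneg_right huv (by norm_num)) hm3 (by positivity) (by positivity))
    linarith
  -- group 2: `2 |radial'(a²)| (a + b) ≤ const`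
  have hG2 : 2 * |-7 * (ia ^ 2) ^ 8 + 4 * (ia ^ 2) ^ 5| * (a + b) * d ≤ 1200000 * d := by
    have hr : |-7 * (ia ^ 2) ^ 8 + 4 * (ia ^ 2) ^ 5| ≤ 7 * ia ^ 16 + 4 * ia ^ 10 := by
      have h1 : |-7 * (ia ^ 2) ^ 8| = 7 * ia ^ 16 := by
        rw [abs_mul, abs_neg, abs_of_pos (by norm_num : (0 : ℝ) < 7), abs_of_nonneg (by positivity)]
        ring
      have h2 : |4 * (ia ^ 2) ^ 5| = 4 * ia ^ 10 := by
        rw [abs_mul, abs_of_pos (by norm_num : (0 : ℝ) < 4), abs_of_nonneg (by positivity)]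
        ring
      calc |-7 * (ia ^ 2) ^ 8 + 4 * (ia ^ 2) ^ 5| ≤ |-7 * (ia ^ 2) ^ 8| + |4 * (ia ^ 2) ^ 5| := abs_add_le _ _
        _ = 7 * ia ^ 16 + 4 * ia ^ 10 := by rw [h1, h2]
    have hsum : a + b ≤ 2 * a + 1 / 4 := by linarith
    have e16 : ia ^ 16 * a = ia ^ 15 := by
      calc ia ^ 16 * a = ia ^ 15 * (ia * a) := by ring
        _ = ia ^ 15 := by rw [hia1, mul_one]
    have e10 : ia ^ 10 * a = ia ^ 9 := by
      calc ia ^ 10 * a = ia ^ 9 * (ia * a) := by ring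
        _ = ia ^ 9 := by rw [hia1, mul_one]
    have hK : (7 * ia ^ 16 + 4 * ia ^ 10) * (2 * a + 1 / 4) ≤ 600000 := by
      have e : (7 * ia ^ 16 + 4 * ia ^ 10) * (2 * a + 1 / 4) =
          14 * (ia ^ 16 * a) + 8 * (ia ^ 10 * a) + 7 / 4 * ia ^ 16 + ia ^ 10 := by ring
      rw [e, e16, e10]
      have h15 := hpa 15
      have h9 := hpa 9
      have h16 := hpa 16
      have h10 := hpa 10
      norm_num at h15 h9 h16 h10
      linarith
    have h1 : |-7 * (ia ^ 2) ^ 8 + 4 * (ia ^ 2) ^ 5| * (a + b) ≤ 600000 :=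
      (mul_le_mul hr hsum (by linarith) (by positivity)).trans hK
    have := mul_le_mul_of_nonneg_right h1 hd0
    linarith
  -- group 3: `2 |Δ radial'| b² ≤ const · d`
  have hG3 : 2 * |(-7 * (ia ^ 2) ^ 8 + 4 * (ia ^ 2) ^ 5) - (-7 * (ib ^ 2) ^ 8 + 4 * (ib ^ 2) ^ 5)| * b ^ 2
      ≤ 10000000 * d := by
    have h8 := abs_pow_sub_pow_le (ia ^ 2) (ib ^ 2) 8
    have h5 := abs_pow_sub_pow_le (ia ^ 2) (ib ^ 2) 5
    simp only [Nat.cast_ofNat, show (8 : ℕ) - 1 = 7 from rfl, show (5 : ℕ) - 1 = 4 from rfl] at h8 h5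
    have hm7 : max |ia ^ 2| |ib ^ 2| ^ 7 ≤ 4 ^ 7 := pow_le_pow_left₀ hmax0 hmax 7
    have hm4 : max |ia ^ 2| |ib ^ 2| ^ 4 ≤ 4 ^ 4 := pow_le_pow_left₀ hmax0 hmax 4
    have e : (-7 * (ia ^ 2) ^ 8 + 4 * (ia ^ 2) ^ 5) - (-7 * (ib ^ 2) ^ 8 + 4 * (ib ^ 2) ^ 5) =
        -7 * ((ia ^ 2) ^ 8 - (ib ^ 2) ^ 8) + 4 * ((ia ^ 2) ^ 5 - (ib ^ 2) ^ 5) := by ring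
    rw [e]
    have hsplit : |-7 * ((ia ^ 2) ^ 8 - (ib ^ 2) ^ 8) + 4 * ((ia ^ 2) ^ 5 - (ib ^ 2) ^ 5)|
        ≤ 7 * |(ia ^ 2) ^ 8 - (ib ^ 2) ^ 8| + 4 * |(ia ^ 2) ^ 5 - (ib ^ 2) ^ 5| := by
      refine (abs_add_le _ _).trans (le_of_eq ?_)
      rw [abs_mul, abs_mul, show |(-7 : ℝ)| = 7 by norm_num, show |(4 : ℝ)| = 4 by norm_num]
    have hb2 : 0 ≤ b ^ 2 := sq_nonneg b
    have h8b : |(ia ^ 2) ^ 8 - (ib ^ 2) ^ 8| * b ^ 2 ≤ 5 * d * 8 * 4 ^ 7 := by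
      have step := mul_le_mul_of_nonneg_right h8 hb2
      have e2 : |ia ^ 2 - ib ^ 2| * 8 * max |ia ^ 2| |ib ^ 2| ^ 7 * b ^ 2 =
          (|ia ^ 2 - ib ^ 2| * b ^ 2) * 8 * max |ia ^ 2| |ib ^ 2| ^ 7 := by ring
      rw [e2] at step
      exact step.trans (mul_le_mul (mul_le_mul_of_nonneg_right huvb (by norm_num)) hm7 (by positivity) (by positivity))
    have h5b : |(ia ^ 2) ^ 5 - (ib ^ 2) ^ 5| * b ^ 2 ≤ 5 * d * 5 * 4 ^ 4 := by
      have step := mul_le_mul_of_nonneg_right h5 hb2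
      have e2 : |ia ^ 2 - ib ^ 2| * 5 * max |ia ^ 2| |ib ^ 2| ^ 4 * b ^ 2 =
          (|ia ^ 2 - ib ^ 2| * b ^ 2) * 5 * max |ia ^ 2| |ib ^ 2| ^ 4 := by ring
      rw [e2] at step
      exact step.trans (mul_le_mul (mul_le_mul_of_nonneg_right huvb (by norm_num)) hm4 (by positivity) (by positivity))
    have hmain := mul_le_mul_of_nonneg_right hsplit hb2
    calc 2 * |-7 * ((ia ^ 2) ^ 8 - (ib ^ 2) ^ 8) + 4 * ((ia ^ 2) ^ 5 - (ib ^ 2) ^ 5)| * b ^ 2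
        ≤ 2 * ((7 * |(ia ^ 2) ^ 8 - (ib ^ 2) ^ 8| + 4 * |(ia ^ 2) ^ 5 - (ib ^ 2) ^ 5|) * b ^ 2) := by
          linarith [hmain]
      _ = 14 * (|(ia ^ 2) ^ 8 - (ib ^ 2) ^ 8| * b ^ 2) + 8 * (|(ia ^ 2) ^ 5 - (ib ^ 2) ^ 5| * b ^ 2) := by ring
      _ ≤ 14 * (5 * d * 8 * 4 ^ 7) + 8 * (5 * d * 5 * 4 ^ 4) := by linarith [h8b, h5b]
      _ ≤ 10000000 * d := by linarith
  linarith

/-- ★ **Lipschitz bound of the pair-force Jacobian off the core, within a quarter step**: `‖pairJac y − pairJac z‖ ≤ 2·10⁷·‖y − z‖` for `‖z‖ ≥ 27/32`,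
`‖y − z‖ ≤ 1/4`. [this file, g55] -/
theorem norm_pairJac_sub_le {y z : E3} (hz : 27 / 32 ≤ ‖z‖) (hyz : ‖y - z‖ ≤ 1 / 4) :
    ‖pairJac y - pairJac z‖ ≤ 20000000 * ‖y - z‖ := by
  have hab : |‖y‖ - ‖z‖| ≤ ‖y - z‖ := abs_norm_sub_norm_le y z
  have ha : 19 / 32 ≤ ‖y‖ := by
    have := neg_le_of_abs_le hab
    linarith
  have hb' : ‖z‖ ≤ ‖y‖ + 1 / 4 := by
    have := neg_le_of_abs_le hab
    linarith
  have hcoef := pairJac_coeff_bound ha hz hab hb'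
  refine ContinuousLinearMap.opNorm_le_bound _ (by positivity) fun D => ?_
  have hsub : (pairJac y - pairJac z) D = pairJac y D - pairJac z D := rfl
  rw [hsub, pairJac_apply, pairJac_apply]
  simp only [radial, radial']
  set ry : ℝ := (‖y‖ ^ 2)⁻¹ ^ 7 - (‖y‖ ^ 2)⁻¹ ^ 4
  set rz : ℝ := (‖z‖ ^ 2)⁻¹ ^ 7 - (‖z‖ ^ 2)⁻¹ ^ 4
  set qy : ℝ := -7 * (‖y‖ ^ 2)⁻¹ ^ 8 + 4 * (‖y‖ ^ 2)⁻¹ ^ 5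
  set qz : ℝ := -7 * (‖z‖ ^ 2)⁻¹ ^ 8 + 4 * (‖z‖ ^ 2)⁻¹ ^ 5
  have e : ry • D + (2 * qy * ⟪y, D⟫) • y - (rz • D + (2 * qz * ⟪z, D⟫) • z) =
      (ry - rz) • D + (2 * qy * ⟪y, D⟫) • (y - z) + (2 * qy * ⟪y - z, D⟫) • z + (2 * (qy - qz) * ⟪z, D⟫) • z := by
    rw [inner_sub_left]
    module
  rw [e]
  have hyD : |⟪y, D⟫| ≤ ‖y‖ * ‖D‖ := abs_real_inner_le_norm y D
  have hzD : |⟪z, D⟫| ≤ ‖z‖ * ‖D‖ := abs_real_inner_le_norm z D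
  have hyzD : |⟪y - z, D⟫| ≤ ‖y - z‖ * ‖D‖ := abs_real_inner_le_norm (y - z) D
  have n1 : ‖(ry - rz) • D‖ = |ry - rz| * ‖D‖ := by rw [norm_smul, Real.norm_eq_abs]
  have n2 : ‖(2 * qy * ⟪y, D⟫) • (y - z)‖ ≤ 2 * |qy| * (‖y‖ * ‖D‖) * ‖y - z‖ := by
    rw [norm_smul, Real.norm_eq_abs, abs_mul, abs_mul, abs_two]
    exact mul_le_mul_of_nonneg_right (mul_le_mul_of_nonneg_left hyD (by positivity)) (norm_nonneg _)
  have n3 : ‖(2 * qy * ⟪y - z, D⟫) • z‖ ≤ 2 * |qy| * (‖y - z‖ * ‖D‖) * ‖z‖ := by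
    rw [norm_smul, Real.norm_eq_abs, abs_mul, abs_mul, abs_two]
    exact mul_le_mul_of_nonneg_right (mul_le_mul_of_nonneg_left hyzD (by positivity)) (norm_nonneg _)
  have n4 : ‖(2 * (qy - qz) * ⟪z, D⟫) • z‖ ≤ 2 * |qy - qz| * (‖z‖ * ‖D‖) * ‖z‖ := by
    rw [norm_smul, Real.norm_eq_abs, abs_mul, abs_mul, abs_two]
    exact mul_le_mul_of_nonneg_right (mul_le_mul_of_nonneg_left hzD (by positivity)) (norm_nonneg _)
  have hD : 0 ≤ ‖D‖ := norm_nonneg D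
  calc ‖(ry - rz) • D + (2 * qy * ⟪y, D⟫) • (y - z) + (2 * qy * ⟪y - z, D⟫) • z + (2 * (qy - qz) * ⟪z, D⟫) • z‖
      ≤ ‖(ry - rz) • D‖ + ‖(2 * qy * ⟪y, D⟫) • (y - z)‖ + ‖(2 * qy * ⟪y - z, D⟫) • z‖ + ‖(2 * (qy - qz) * ⟪z, D⟫) • z‖ :=
        (norm_add_le _ _).trans (add_le_add ((norm_add_le _ _).trans (add_le_add (norm_add_le _ _) le_rfl)) le_rfl)
    _ ≤ (|ry - rz| + 2 * |qy| * (‖y‖ + ‖z‖) * ‖y - z‖ + 2 * |qy - qz| * ‖z‖ ^ 2) * ‖D‖ := by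
        rw [n1]; linarith [n2, n3, n4]
    _ ≤ 20000000 * ‖y - z‖ * ‖D‖ := mul_le_mul_of_nonneg_right hcoef hD

/-- ★★ **(I1) PROVED — `PairForceTaylorP`** with `C = 2·10⁷`: the mean-value inequality `Convex.norm_image_sub_le_of_norm_hasFDerivWithin_le'` on the ball
`closedBall z ‖h‖` (inside `‖·‖ ≥ 19/32`, where `pairForce` has derivative `pairJac`, tree `hasFDerivAt_pairForce`) against the fixed linear map `pairJac z`,
with the Lipschitz bound `norm_pairJac_sub_le`; then `forceConst z h = −pairJac z h`. [this file, g55] -/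
theorem pairForceTaylorP_holds : PairForceTaylorP := by
  refine ⟨20000000, by norm_num, fun z h hz hh => ?_⟩
  have hseg : ∀ y ∈ closedBall z ‖h‖, HasFDerivWithinAt pairForce (pairJac y) (closedBall z ‖h‖) y := by
    intro y hy
    have hy' : ‖y - z‖ ≤ 1 / 4 := (mem_closedBall_iff_norm.1 hy).trans hh
    have hyn : 19 / 32 ≤ ‖y‖ := by
      have := neg_le_of_abs_le (abs_norm_sub_norm_le y z)
      linarith
    have hy0 : y ≠ 0 := by
      intro e
      rw [e, norm_zero] at hyn
      linarith
    exact (hasFDerivAt_pairForce hy0).hasFDerivWithinAt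
  have hbound : ∀ y ∈ closedBall z ‖h‖, ‖pairJac y - pairJac z‖ ≤ 20000000 * ‖h‖ := by
    intro y hy
    have hy1 : ‖y - z‖ ≤ ‖h‖ := mem_closedBall_iff_norm.1 hy
    exact (norm_pairJac_sub_le hz (hy1.trans hh)).trans (by linarith)
  have hz_mem : z ∈ closedBall z ‖h‖ := mem_closedBall_self (norm_nonneg h)
  have hzh_mem : z + h ∈ closedBall z ‖h‖ := by
    rw [mem_closedBall_iff_norm, add_sub_cancel_left]
  have key := (convex_closedBall z ‖h‖).norm_image_sub_le_of_norm_hasFDerivWithin_le' hseg hbound hz_mem hzh_mem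
  rw [add_sub_cancel_left] at key
  have e : pairForce (z + h) - pairForce z + forceConst z h = pairForce (z + h) - pairForce z - pairJac z h := by
    rw [forceConst_apply_eq_neg_pairJac, ← sub_eq_add_neg]
  rw [e]
  calc ‖pairForce (z + h) - pairForce z - pairJac z h‖ ≤ 20000000 * ‖h‖ * ‖h‖ := key
    _ = 20000000 * ‖h‖ ^ 2 := by ring

/-! ### UP.2  The glue with its three PROVABLE·S antecedents discharged (PROVED) -/

/-- ★★ **[CC°_Ψᵇ] from the glue and the remaining pieces (PROVED modus ponens, (I0), (I1), (I5) discharged by parts UO, UP)**: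
glue ∧ (I4) ∧ hU ∧ hN ∧ [KS] ∧ [SBᵇ] ⇒ [CC°_Ψᵇ]. [this file, g55] -/
theorem coherentGscCaccioppoliPsiBPG_of_pieces' {ϑ aHi Λ θ s ν : ℝ} (hglue : CaccioppoliGlueBPG ϑ aHi Λ θ s ν) (h4 : TailFluxBP aHi Λ θ s)
    (hU : UniformTameStabilityE s Λ ν) (hN : EnergyNearChartPX aHi Λ θ s ν) (hKS : KornSobolevPoincareP aHi θ) (hSB : SubWindowBudgetBPG ϑ aHi Λ θ s) :
    CoherentGscCaccioppoliPsiBPG ϑ aHi Λ θ s :=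
  coherentGscCaccioppoliPsiBPG_of_pieces hglue equilChartIsometryP_holds pairForceTaylorP_holds h4 caccioppoliIterationP_holds hU hN hKS hSB

/-- Record example: the docket of record through the glue at column `_16XH19B`'s literals (`ν = 1/2000`; hU, hN are that column's certs), (I0), (I1), (I5)
discharged: residuals [T_bᵇ], [W_Ψᵇ], and beneath [CC°_Ψᵇ] the glue, (I4), [SBᵇ]. -/
example (hG : ZatorskaGoldstein2005_localGehringLemmaCounting)
    (hI : DressedCorePG tameRadius dressLevel dressLevel dressExponent 8 collarRadius clusterSize 1 2 (1 / 16) (1 / 50))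
    (hTb : BareTameWindowBPG tameRadius dressLevel dressLevel dressExponent 8 collarRadius clusterSize 1 2 (1 / 16) (1 / 50))
    (hKS : KornSobolevPoincareP 1 (1 / 16)) (hW : CoherentWindowPsiBPG tameRadius 1 2 (1 / 16) (1 / 50))
    (hglue : CaccioppoliGlueBPG tameRadius 1 2 (1 / 16) (1 / 50) (1 / 2000)) (h4 : TailFluxBP 1 2 (1 / 16) (1 / 50))
    (hU : UniformTameStabilityE (1 / 50) 2 (1 / 2000)) (hN : EnergyNearChartPX 1 2 (1 / 16) (1 / 50) (1 / 2000))
    (hSB : SubWindowBudgetBPG tameRadius 1 2 (1 / 16) (1 / 50)) :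
    StrainNonConcentrationBPG 1 2 (1 / 16) (1 / 50) :=
  strainNonConcentrationBPG_1_50_of_docketPsi hG hI hTb hKS hW (coherentGscCaccioppoliPsiBPG_of_pieces' hglue h4 hU hN hKS hSB)

/-- Record example, pure modus ponens at the literals: the three discharged pieces are theorems of the tree after parts UO, UP. -/
example : EquilChartIsometryP ∧ PairForceTaylorP ∧ CaccioppoliIterationP :=
  ⟨equilChartIsometryP_holds, pairForceTaylorP_holds, caccioppoliIterationP_holds⟩

end Summit.AtomisticToContinuum.Crystallization.Theorems.ChartedZeroExcessLayeredLatticeLiouville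

end
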